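import Mathlib
import Literature.NumberTheory.Transcendental.PeriodsWave0
import HarnessLib

/-!
# Schanuel — problem statement (D-0007: predetermined problem; this file is CREATED BY THE OPERATOR via docs/m5/create_problems.py, never proposed by agents)

Prop-valued definitions (main statement + variants), assembled by the M5 migration from:
* `harness21/H21/H21/Statements/Periods/Wave0.lean` (1 defs)
-/

-- provenance: harness21/H21/H21/Statements/Periods/Wave0.lean @ fe6eab2 (interim HEAD d8f2665); M5 mechanical rewrite
noncomputable section

open Complex

namespace Literature.Periods

/-! ### Schanuel, Lindemann–Weierstrass, Hermite–Lindemann -/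

/-- **periods.S09** (Schanuel's conjecture; Lang, *Introduction to transcendental numbers* (1966)
pp. 30–31; Waldschmidt 2000, Conjecture 1.14; Waldschmidt 2004, Conjecture 3.1). If `z₁, …, zₙ ∈ ℂ` are linearly independent over `ℚ`,
then the field `ℚ(z₁, …, zₙ, e^{z₁}, …, e^{zₙ})` has transcendence degree at least `n` over `ℚ`.
Open. [cite: Waldschmidt2000, Conjecture 1.14] [problem: periods] -/
def SchanuelConjecture : Prop :=
  ∀ (n : ℕ) (z : Fin n → ℂ), LinearIndependent ℚ z →
    (n : Cardinal) ≤ Algebra.trdeg ℚ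
      ↥(IntermediateField.adjoin ℚ (Set.range z ∪ Set.range (cexp ∘ z)))

/-! ### Gelfond–Schneider, Baker, six exponentials -/

/-! ### `e` and `π`; Nesterenko -/

/-! ### Zeta values -/

/-! ### Euler–Mascheroni and Catalan -/

end Literature.Periods

/-- The `Schanuel` problem statement (D-0010; canonical root-level name checked by the gate) := `Literature.Periods.SchanuelConjecture`. [problem: periods] -/
def Schanuel : Prop := Literature.Periods.SchanuelConjecture
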